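import Mathlib
import HarnessLib
import Summits.Ventures.LatticeQCDFlow.Exactness.PTBCWilsonDefect

/-!
# The PTBC swap energy is local to the defect, and its K-product (`c ^ m`) form

HONEST FRAMING: exact (Metropolis-corrected) sampling algorithms for lattice gauge theory;
figures of merit are autocorrelation/cost numbers at stated couplings and volumes; no
continuum-physics claim.

Venture `LatticeQCDFlow` (cell pub-lqcd), topic `Exactness`; FANOUT row 22 (`su3-ptbc`, the E4
parallel-tempering-on-boundary-conditions arm; production driver `HOME/su3-ptbc/code/ptbc/ptbc_lf.py`,
functions `defect_X` / `dS_swap`, parity test L2 of `test_lf_parity.py`).  NEW WORK of the cell: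
elementary finite-sum identities over the tree's defect-weighted Wilson action
`weightedWilsonAction` (`PTBCWilsonDefect.lean`, row 9).  Nothing here is cited as a fact.

## Content

The Metropolis swap of two PTBC replicas with weight fields `w` (holding the configuration `U`) and
`w'` (holding `U'`) is accepted with probability `min (1, e^{−ΔS})`,
`ΔS = S_w(U') + S_{w'}(U) − S_w(U) − S_{w'}(U')` (`PTBCSwap.lean`: `ptbcSwap`, `involAccept_ptbcSwap`),
where `S_w(U) = Σ_p w_p (N − Re tr ρ(U_p))`.

* `swapEnergy_eq_sum` — `ΔS = Σ_p (w_p − w'_p) · (f(U_p) − f(U'_p))` with `f = Re tr ρ`: the constant `N`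
  and every plaquette carrying equal weights in the two replicas drop out; `swapEnergy_symm`,
  `swapEnergy_reverse`, `swapEnergy_self` (relabelling, reverse move, equal weights);
* `swapEnergy_eq_sum_of_subset` — **locality**: for ANY finset `D` of plaquettes containing those on
  which the two weight fields differ, `ΔS` is the same sum restricted to `D` — the swap decision
  costs `O(|D|)` (the plaquettes touching the defect), not `O(volume)`
  (Bonanno–Bonati–D'Elia 2021 §2.3; arXiv:2403.13607 §3 'one does not need to iterate over the
  whole lattice' — quoted as motivation only, nothing is used from print);
* `swapEnergy_kProduct` — for the printed **K-product weights** `w_c(p) = c ^ m(p)` (`m(p)` = the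
  number of defect links among the four links of `p`; `m = 0` off the defect, so `w = 1` there;
  `c = 1` is the periodic replica, `c = 0` the open one) and any bound `M ≥ m`:
  `ΔS = Σ_{k=0}^{M} (c^k − c'^k) · (X_k(U) − X_k(U'))` with the **defect energies**
  `X_k(U) = Σ_{p : m(p) = k} f(U_p)`; the `k = 0` summand vanishes identically
  (`swapEnergy_kProduct_pos`: the sum may start at `k = 1`), so in four dimensions (`m ≤ 2`) each
  replica contributes exactly two scalars `X₁, X₂` to every swap test — the quantities row 22's
  driver computes in `O(L_d³)` and exchanges between replica slots.

## Not here

Which plaquettes of the torus have `m(p) = k` for the `L_d³` cube defect (geometry); the Metropolis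
step and its reversibility (`PTBCSwap.lean`); invariance / ergodicity of the PTBC cycle
(`PTBCWilsonDefect.lean`, `PTBCSwapErgodic.lean`); any cost or autocorrelation number.
-/

noncomputable section

namespace Summit.Ventures.LatticeQCDFlow.Exactness

open Literature.MathematicalPhysics.QuantumFieldTheory

variable {d L N : ℕ} {G : Type*} [Group G] (ρ : G →* Matrix (Fin N) (Fin N) ℂ)

/-! ## §0 The printed K-product weights (no hypothesis on `L`) -/

/-- The printed **K-product plaquette weight** of a PTBC replica with defect coupling `c`:
`w_c(p) = c ^ m(p)`, `m(p)` = the number of defect links of `p` (so `w = 1` off the defect;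
`c = 1`: periodic replica, `c = 0`: open across the defect). -/
def kProductWeight (m : Plaquette d L → ℕ) (c : ℝ) (p : Plaquette d L) : ℝ := c ^ m p

/-- `c = 1` gives unit weights everywhere (the periodic, physical replica). -/
theorem kProductWeight_one (m : Plaquette d L → ℕ) (p : Plaquette d L) : kProductWeight m 1 p = 1 :=
  one_pow _

/-- Off the defect (`m(p) = 0`) every replica carries weight `1`. -/
theorem kProductWeight_of_eq_zero (m : Plaquette d L → ℕ) (c : ℝ) {p : Plaquette d L} (hp : m p = 0) :
    kProductWeight m c p = 1 := by
  simp only [kProductWeight, hp, pow_zero]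

variable [NeZero L]

/-! ## §1 The swap energy and its locality -/

/-- The plaquette value `f(U_p) = Re tr ρ(U_p)` entering the (weighted) Wilson action. -/
def plaqValue (U : GaugeConfig d L G) (p : Plaquette d L) : ℝ :=
  (ρ (plaquetteHolonomy U p.1 p.2.1.1 p.2.1.2)).trace.re

/-- The defect-weighted Wilson action written with `plaqValue`:
`S_w(U) = Σ_p w_p (N − f(U_p))` (definitionally `weightedWilsonAction`). -/
theorem weightedWilsonAction_eq_sum_plaqValue (w : Plaquette d L → ℝ) (U : GaugeConfig d L G) :
    weightedWilsonAction w ρ U = ∑ p, w p * ((N : ℝ) - plaqValue ρ U p) := rfl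

/-- **The PTBC swap energy** of two replicas with weight fields `w` (holding `U`) and `w'`
(holding `U'`): `ΔS = S_w(U') + S_{w'}(U) − S_w(U) − S_{w'}(U')`, the exponent of the Metropolis
swap test `min (1, e^{−ΔS})` (the `ΔS` of `PTBCSwap.lean` for the two weighted Wilson actions). -/
def swapEnergy (w w' : Plaquette d L → ℝ) (U U' : GaugeConfig d L G) : ℝ :=
  weightedWilsonAction w ρ U' + weightedWilsonAction w' ρ U
    - weightedWilsonAction w ρ U - weightedWilsonAction w' ρ U'

/-- `ΔS = Σ_p (w_p − w'_p) · (f(U_p) − f(U'_p))`: the constant `N` cancels and so does every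
plaquette on which the two replicas carry the same weight. -/
theorem swapEnergy_eq_sum (w w' : Plaquette d L → ℝ) (U U' : GaugeConfig d L G) :
    swapEnergy ρ w w' U U' = ∑ p, (w p - w' p) * (plaqValue ρ U p - plaqValue ρ U' p) := by
  unfold swapEnergy
  rw [weightedWilsonAction_eq_sum_plaqValue, weightedWilsonAction_eq_sum_plaqValue,
    weightedWilsonAction_eq_sum_plaqValue, weightedWilsonAction_eq_sum_plaqValue,
    ← Finset.sum_add_distrib, ← Finset.sum_sub_distrib, ← Finset.sum_sub_distrib]
  exact Finset.sum_congr rfl fun p _ => by ring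

/-- Relabelling the two replicas (weights AND configurations together) is the same swap:
`ΔS(w', w; U', U) = ΔS(w, w'; U, U')`. -/
theorem swapEnergy_symm (w w' : Plaquette d L → ℝ) (U U' : GaugeConfig d L G) :
    swapEnergy ρ w' w U' U = swapEnergy ρ w w' U U' := by
  unfold swapEnergy
  ring

/-- The reverse move (configurations exchanged back) has the opposite energy:
`ΔS(w, w'; U', U) = −ΔS(w, w'; U, U')` — the bookkeeping behind the swap's detailed balance. -/
theorem swapEnergy_reverse (w w' : Plaquette d L → ℝ) (U U' : GaugeConfig d L G) :
    swapEnergy ρ w w' U' U = -swapEnergy ρ w w' U U' := by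
  unfold swapEnergy
  ring

/-- Equal weight fields never reject: `ΔS = 0` (two copies of the same replica). -/
theorem swapEnergy_self (w : Plaquette d L → ℝ) (U U' : GaugeConfig d L G) :
    swapEnergy ρ w w U U' = 0 := by
  rw [swapEnergy_eq_sum]
  exact Finset.sum_eq_zero fun p _ => by rw [sub_self, zero_mul]

/-- **Locality of the swap energy.**  For every finset `D` of plaquettes containing all plaquettes on
which the two weight fields differ, `ΔS = Σ_{p ∈ D} (w_p − w'_p) · (f(U_p) − f(U'_p))`: the swap
decision reads only the plaquettes touching the defect. -/
theorem swapEnergy_eq_sum_of_subset (w w' : Plaquette d L → ℝ) (U U' : GaugeConfig d L G)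
    (D : Finset (Plaquette d L)) (hD : ∀ p, w p ≠ w' p → p ∈ D) :
    swapEnergy ρ w w' U U' = ∑ p ∈ D, (w p - w' p) * (plaqValue ρ U p - plaqValue ρ U' p) := by
  rw [swapEnergy_eq_sum]
  symm
  refine Finset.sum_subset (Finset.subset_univ D) fun p _ hp => ?_
  have hw : w p = w' p := by
    by_contra h
    exact hp (hD p h)
  rw [hw, sub_self, zero_mul]

/-! ## §2 Defect energies and the driver's swap formula -/

/-- **Defect energies** `X_k(U) = Σ_{p : m(p) = k} f(U_p)`: the scalars a replica slot contributes to
every swap test (row 22's `defect_X`; `k = 1, 2` in four dimensions). -/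
def defectEnergy (m : Plaquette d L → ℕ) (k : ℕ) (U : GaugeConfig d L G) : ℝ :=
  ∑ p ∈ Finset.univ.filter (fun p => m p = k), plaqValue ρ U p

/-- **The driver's swap formula.**  With K-product weights and any bound `M` on the defect
multiplicity, `ΔS = Σ_{k=0}^{M} (c^k − c'^k) · (X_k(U) − X_k(U'))` (row 22's `dS_swap`, checked
against brute-force weighted actions to `1e-12` by parity test L2 — here as an identity). -/
theorem swapEnergy_kProduct (m : Plaquette d L → ℕ) {M : ℕ} (hM : ∀ p, m p ≤ M) (c c' : ℝ)
    (U U' : GaugeConfig d L G) :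
    swapEnergy ρ (kProductWeight m c) (kProductWeight m c') U U' =
      ∑ k ∈ Finset.range (M + 1),
        (c ^ k - c' ^ k) * (defectEnergy ρ m k U - defectEnergy ρ m k U') := by
  rw [swapEnergy_eq_sum]
  have hmaps : ∀ p ∈ (Finset.univ : Finset (Plaquette d L)), m p ∈ Finset.range (M + 1) :=
    fun p _ => Finset.mem_range.2 (Nat.lt_succ_of_le (hM p))
  rw [← Finset.sum_fiberwise_of_maps_to hmaps]
  refine Finset.sum_congr rfl fun k _ => ?_
  unfold defectEnergy
  rw [← Finset.sum_sub_distrib, Finset.mul_sum]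
  refine Finset.sum_congr rfl fun p hp => ?_
  have hk : m p = k := (Finset.mem_filter.1 hp).2
  simp only [kProductWeight, hk]

/-- The `k = 0` summand of `swapEnergy_kProduct` vanishes (`c^0 − c'^0 = 0`), so the sum may start at
`k = 1`: in four dimensions (`m ≤ 2`) only `X₁` and `X₂` of each replica are needed. -/
theorem swapEnergy_kProduct_pos (m : Plaquette d L → ℕ) {M : ℕ} (hM : ∀ p, m p ≤ M) (c c' : ℝ)
    (U U' : GaugeConfig d L G) :
    swapEnergy ρ (kProductWeight m c) (kProductWeight m c') U U' =
      ∑ k ∈ Finset.Ico 1 (M + 1),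
        (c ^ k - c' ^ k) * (defectEnergy ρ m k U - defectEnergy ρ m k U') := by
  rw [swapEnergy_kProduct ρ m hM, Finset.range_eq_Ico, Finset.sum_eq_sum_Ico_succ_bot (Nat.succ_pos M)]
  simp only [pow_zero, sub_self, zero_mul, zero_add]

/-- The periodic replica against the open one (`c = 1`, `c' = 0`): `ΔS = Σ_{k=1}^{M} (X_k(U) − X_k(U'))`
— every defect plaquette enters with unit coefficient. -/
theorem swapEnergy_kProduct_one_zero (m : Plaquette d L → ℕ) {M : ℕ} (hM : ∀ p, m p ≤ M)
    (U U' : GaugeConfig d L G) :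
    swapEnergy ρ (kProductWeight m 1) (kProductWeight m 0) U U' =
      ∑ k ∈ Finset.Ico 1 (M + 1), (defectEnergy ρ m k U - defectEnergy ρ m k U') := by
  rw [swapEnergy_kProduct_pos ρ m hM]
  refine Finset.sum_congr rfl fun k hk => ?_
  have hk1 : 1 ≤ k := (Finset.mem_Ico.1 hk).1
  rw [one_pow, zero_pow (Nat.pos_iff_ne_zero.1 hk1), sub_zero, one_mul]

end Summit.Ventures.LatticeQCDFlow.Exactness

end
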